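/-
Copyright: statement-level skeleton of a published paper (lit-balaban cell, Phase-2 proof seat p32 gen 49). No claims beyond
what the kernel checks below.
-/
import Literature.MathematicalPhysics.QuantumFieldTheory.Balaban1983to89.B3Eq121CouplingInsertion

/-!
# B3 — T. Bałaban, *(Higgs)₂,₃ quantum fields in a finite volume. III. Renormalization*, CMP **88** (1983) 411–445
[Balaban1983Higgs3], p. 417 [PDF 7], the defining equations of the mass counterterm (1.23):
**«THIS EQUATION CAN BE SOLVED RECURSIVELY IF δm² AND Σ^ε ARE EXPANDED INTO POWER SERIES IN e, λ»** — on the lineage's formal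
two-point expansion (1.21) with δm² = Σ_{2≦α+2β≦4} e^αλ^βδm²_{(α,β)} inserted (FILE `B3Eq121CouplingInsertion` of this seat):
the order-(α, β) coefficient of the inserted self-energy is TRIANGULAR in the weight α + 2β, and the fixed-point system
δm²_{(α,β)} = L_{αβ}(Σ^ε_{(α,β)}[δm²]) (2 ≦ α + 2β ≦ 4) has EXACTLY ONE solution, constructed weight by weight

statement-level skeleton of published theorems with citation tags; proofs where landed; nothing here is a claim about
the Yang–Mills mass gap

HEAD VIEW
```
object        : p. 417: «usually it is defined as a solution of the equation −δm² + Σ_{x∈T_ε}ε^dΣ^ε(x) = 0. This equation can be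
                solved recursively if δm² and Σ^ε are expanded into power series in e, λ. In our case δm² will be defined by the
                terms of order ≦ 4. More exactly we write δm² = Σ_{2≦α+2β≦4} e^αλ^βδm²_{(α,β)} and we insert this into Σ^ε …
                The counterterms δm²_{(α,β)} are defined by the equations −δm²_{(α,β)} + Σ_{x∈T_ε}ε^dΣ^ε_{(α,β)}(x) = 0.»
given         : FILE `B3Eq121CouplingInsertion` (this seat, gen 49): the insertion morphism `insert123 δ` and the order-by-order
                formula `coeff_letterSeries_inserted` for the inserted symmetry-weighted letter series of the lineage; p26's
                `B3Eq123Counterterms.recursion_order_four` (the recursion checked on the seven DISPLAYED terms of (1.22)/(1.23))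
action        : (§1) a connected two-leg insertion with d_s = d_v = 0 has at least TWO vertices (1.7) — the bare −δm² vertex is
                not a letter of Σ^ε (leg counting on p18's carrier with g45/g48's (1.13)-lemmas); (§2) the recursion weight
                α + 2β as a weight on the letters (λ ↦ 2, e ↦ 1): weighted orders of the inserted δm², of differences of its
                powers, of the monomial inserted for one graph; (§3) TRIANGULARITY: if δ, δ′ agree at all weights < α + 2β then
                the order-(α, β) coefficients of the inserted self-energies agree; (§4) the fixed-point system for SUPPLIED
                functionals L_{αβ} of the kernel (print: K ↦ Σ_{x′}ε^dK(x, x′)): recursive construction `dm2Sol`, `dm2Sol_solves`,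
                uniqueness `solvesEq123_unique`, `existsUnique_solvesEq123`, support on `idx123`, the printed equation `dm2Sol_eq123`
not claimed   : any value of the solution (print's displayed (1.23) is p26's business), the choice of L (a parameter; r15's
                `dm2Graph`/`dm2Coeff` are the instances of record), convergence of −δm² + Σ^ε (analytic, Prop. 1), anything at
                orders α + 2β > 4 beyond «δm²_{(α,β)} = 0 there» (print's truncation, taken as the definition)
```

PDF held: `paper:balaban1983-higgs-2-3-quantum-fields-finite-volume` (journal page = PDF page + 410); p. 417 re-read this session
in the store's text layer (file p0007.txt).

CITATION HEADER (lean-in-tree rule).  lit-balaban TYPED SKELETON (HOME `run/shared/lean/pub/lit-balaban/`), PHASE 2, seat p32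
gen 49 (unit `lit-balaban-p32`; TAKING #2, HOME/STATUS.md 2026-08-25; free-target protocol G.5-34(d)), row **B3.Eq1.23** ((1.23)
and its defining equations, p. 417) of `HOME/lit-balaban-r15/ROWS-B3.md` (fold owner r15, referee ref-4; the row's head is
`proved` — member of record p26's `B3Eq123Counterterms`; this file is an OPTIONAL located member of the p. 417 sentence «This
equation can be solved recursively», ZERO head weight), cells of **B3.Eq1.19-1.22** ((1.21) p. 416).  CONSUMES BY NAME: this
seat's `B3Eq121CouplingInsertion.{dm2Series, dm2Term_eq_monomial, a123, monSubst_a123, insert123, coeff_letterSeries_inserted}`,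
g48's `B3Eq121LetterClassOrders.{n17, letterDeg, kind_legIn_ne_v113}`, g45's `B3GraphFiniteOrder.{one_le_ds_add_dv,
isSome_other_legAt113, eq_legAt113, legAt113}`, p37's `B3OnePIChainGlue.TwoLegGraph`, `B3OnePIGraphs.{IsConnected, adj_iff}`,
p32's `B3OnePIChainClasses.{LetterClass, rep, isLetter_rep}`, p33's `B3ClassOrders420.{dsG, dvG}`, r15's `B3Prop1.VertexKind.{ds, dv,
scalarLegs, vectorLegs}`, `B3Sect1TwoPoint.idx123`, FILE 1 / FILE E / p37 as in `B3Eq121CouplingInsertion`; Mathlib's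
`MvPowerSeries.{weightedOrder, nat_le_weightedOrder, coeff_eq_zero_of_lt_weightedOrder, le_weightedOrder_mul, le_weightedOrder_pow,
min_weightedOrder_le_add}`, `Finsupp.weight`, `Relation.ReflTransGen.cases_head`, `Fintype.exists_ne_map_eq_of_card_lt`.
Nothing re-declared; no declaration is added to another file's namespace.

KIND: located bookkeeping member of a printed sentence (G.5-54).  Print asserts the recursive solvability in one sentence and
uses it at the seven displayed orders; p26 checked the displayed recursion (`recursion_order_four`); here the sentence is
proved for the full formal expansion of the lineage: the mechanism is the weight α + 2β (print's own range 2 ≦ α + 2β ≦ 4)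
and the observation, implicit in (1.21)'s separate term −δm², that a one-particle-irreducible two-leg graph carrying a single
δm²-insertion also carries a coupling constant (`two_le_n17_of_orders_zero`).

WHAT IS PROVED (definitions with bodies (bookkeeping) + theorems; no `Prop` fact, no `sorry`; standard axioms).
* `§1` `kind_legOut_ne_v113`, `kind_eq_v17_or_v113_of_orders_zero`, `card_fibre_of_v17`, `legs_at_v17`,
  **`two_le_n17_of_orders_zero`** (connected two-leg graph, d_s = d_v = 0 ⇒ n17 ≥ 2), **`orders_ne_zero_of_n17_le_one`** (letter
  classes).
* `§2` `wt` (λ ↦ 2, e ↦ 1), `weight_exponent` (e^αλ^β weighs α + 2β), `coeff_dm2Series_eq_sum`, **`two_le_weightedOrder_dm2Series`**,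
  **`le_weightedOrder_dm2Series_sub`** (agreement below weight N ⇒ difference of weighted order ≥ N), `le_weightedOrder_pow_sub_pow`,
  `le_weightedOrder_X_pow_mul_X_pow`, **`le_weightedOrder_monSubst_sub`** (orders (d_s, d_v, n+1): difference of weighted order
  ≥ N + 2n + 2d_s + d_v).
* `§3` `coeff_monSubst_letter_congr`, **`coeff_letterSeries_inserted_congr`** (TRIANGULARITY of Σ^ε_{(α,β)}[δ] in the weight).
* `§4` **`dm2Rhs`** (the right side, on `idx123`, for supplied `L`), **`SolvesEq123`**, `dm2Rhs_congr`, **`approx`** (the stages),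
  `approx_stable`, **`dm2Sol`**, `dm2Sol_eq_rhs_approx`, `approx_eq_dm2Sol_of_lt`, **`dm2Sol_solves`** (existence),
  **`solvesEq123_unique`** (uniqueness), **`existsUnique_solvesEq123`**, `dm2Sol_eq_zero_of_not_mem` (support on the seven orders),
  **`dm2Sol_eq123`** (the printed equation −δm²_{(α,β)} + L_{αβ}(Σ^ε_{(α,β)}) = 0 on `idx123`), `dm2Sol_eq123_dm2Graph` (the same
  with print's own functional, r15's `dm2Graph`: −δm²_{(α,β)} + Σ_{x′}ε^dΣ^ε_{(α,β)}(x₀, x′) = 0), **`dm2Sol_eq_sum_letterClasses`**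
  (p. 417's per-graph counterterms δm²_G: for additive L, δm²_{(α,β)} = Σ_c δm²_c over the letter classes of total order ≤ α + β).
HONEST SCOPE.  (i) `L` is a parameter: print's Σ_{x∈T_ε}ε^dΣ^ε_{(α,β)}(x) presupposes translation invariance of the kernel
(r15's `dm2Graph_translationInvariant`); no property of `L` (not even linearity) is used.  (ii) The letters are the lineage's
symmetry-weighted letter classes on p18's carrier (all of (1.6)–(1.15), dressings a parameter), as in `B3Eq121CouplingInsertion`;
print's list for G^ε is (1.6), (1.7), (1.8), (1.10) — `two_le_n17_of_orders_zero` holds on the whole carrier, so no restriction is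
needed.  (iii) The solution is not evaluated: that (1.23)'s displayed counterterms come out at the seven orders is p26's
`B3Eq123Counterterms` (displayed level); nothing analytic; the truncation «order ≦ 4» is taken as print's definition (δ = 0 off
`idx123`), not derived.
Unit `lit-balaban-p32` gen 49 (literature-prover-lit-balaban-p32-g49-0), HOME `run/shared/lean/pub/lit-balaban/`, 2026-08-25.
-/

open Finset MvPowerSeries
open scoped BigOperators

namespace Literature.MathematicalPhysics.QuantumFieldTheory.Balaban1983to89.B3Eq123RecursiveSolution

open B3Prop1 B3Cor23Concrete B3OnePIGraphs B3OnePIChainGlue B3ClassOrders420 B3GraphFiniteOrder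
open B3Eq121LetterClassOrders (n17 kind_legIn_ne_v113)

/-! ## §1 A connected insertion of orders d_s = d_v = 0 carries at least TWO mass counterterms: the bare −δm² vertex is not a
letter of Σ^ε (p. 416: Σ^ε is given by amputated 1PI graphs; the term −δm² stands apart in (1.21)) -/

section Combinatorics

variable {nbar : ℕ}

/-- kernel: the vertex of the OUT-leg of a connected insertion is not an operator vertex (1.13) (as g48's `kind_legIn_ne_v113`).
[cite: Balaban1983Higgs3, (1.13) p.414, p.415, (1.21) p.416] -/
theorem kind_legOut_ne_v113 (T : TwoLegGraph nbar) (hT : IsConnected T.G) : T.G.kind T.legOut.1 ≠ .v113 := by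
  intro h
  have hleg : T.legOut = legAt113 T.G T.legOut.1 h := eq_legAt113 T.G h rfl
  by_cases hV : ∃ j : Fin T.G.nV, j ≠ T.legOut.1
  · obtain ⟨j, hj⟩ := hV
    have hs := isSome_other_legAt113 T.G hT (Ne.symm hj) h
    rw [← hleg, T.out_ext] at hs
    exact Bool.false_ne_true hs
  · push Not at hV
    obtain ⟨x, hx⟩ := T.G.exists_line
    have hxl : x = T.legOut := (eq_legAt113 T.G h (hV x.1)).trans hleg.symm
    rw [hxl, T.out_ext] at hx
    exact Bool.false_ne_true hx

/-- kernel: if d_s(G) = d_v(G) = 0 then every vertex of `G` is a mass-renormalization vertex (1.7) or an operator vertex (1.13)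
(every other admissible vertex carries a coupling constant, p. 420). [cite: Balaban1983Higgs3, p.420, (1.6)–(1.15) pp.413–414] -/
theorem kind_eq_v17_or_v113_of_orders_zero (G : Graph nbar) (hs : dsG G = 0) (hv : dvG G = 0) (i : Fin G.nV) :
    G.kind i = .v17 ∨ G.kind i = .v113 := by
  simp only [dsG, dsOf] at hs
  simp only [dvG, dvOf] at hv
  have hs' : (G.kind i).ds = 0 := (Finset.sum_eq_zero_iff.mp hs) i (Finset.mem_univ i)
  have hv' : (G.kind i).dv = 0 := (Finset.sum_eq_zero_iff.mp hv) i (Finset.mem_univ i)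
  by_contra h
  push Not at h
  have := one_le_ds_add_dv (G.adm i) h.1 h.2
  omega

/-- kernel: a vertex (1.7) has exactly two legs (both φ′). [cite: Balaban1983Higgs3, (1.7) p.413] -/
theorem card_fibre_of_v17 (G : Graph nbar) {i : Fin G.nV} (h : G.kind i = .v17) :
    Fintype.card (Fin (G.kind i).scalarLegs ⊕ Fin (G.kind i).vectorLegs) = 2 := by
  rw [Fintype.card_sum, Fintype.card_fin, Fintype.card_fin, h]
  rfl

/-- kernel: among three legs at one vertex (1.7) two coincide. [cite: Balaban1983Higgs3, (1.7) p.413] -/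
theorem legs_at_v17 (G : Graph nbar) {i : Fin G.nV} (h : G.kind i = .v17) (x y z : Leg G.kind) (hx : x.1 = i) (hy : y.1 = i)
    (hz : z.1 = i) : x = y ∨ x = z ∨ y = z := by
  have hcard : Fintype.card (Fin (G.kind i).scalarLegs ⊕ Fin (G.kind i).vectorLegs) < Fintype.card (Fin 3) := by
    rw [card_fibre_of_v17 G h, Fintype.card_fin]
    norm_num
  obtain ⟨a, s⟩ := x
  obtain ⟨b, t⟩ := y
  obtain ⟨c, u⟩ := z
  dsimp only at hx hy hz
  subst hx
  subst hy
  subst hz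
  obtain ⟨p, q, hpq, hf⟩ := Fintype.exists_ne_map_eq_of_card_lt (![s, t, u]) hcard
  fin_cases p <;> fin_cases q <;> simp_all

/-- **A CONNECTED INSERTION WITH d_s = d_v = 0 HAS AT LEAST TWO VERTICES (1.7)**: its external legs sit at vertices (1.7) (not
at operator vertices (1.13)); were there a single vertex (1.7), both its legs would be the external legs, no line could leave it,
and the graph — which has a line (p. 415) — would be disconnected.  So a letter of Σ^ε carrying exactly one δm² carries a
coupling constant as well: the bare vertex −δm² of (1.21) is not among the letters. [cite: Balaban1983Higgs3, (1.21) p.416, p.417, p.420] -/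
theorem two_le_n17_of_orders_zero (T : TwoLegGraph nbar) (hT : IsConnected T.G) (hs : dsG T.G = 0) (hv : dvG T.G = 0) :
    2 ≤ n17 T.G := by
  have hkind := kind_eq_v17_or_v113_of_orders_zero T.G hs hv
  have hIn : T.G.kind T.legIn.1 = .v17 := (hkind _).resolve_right (kind_legIn_ne_v113 T hT)
  have hOut : T.G.kind T.legOut.1 = .v17 := (hkind _).resolve_right (kind_legOut_ne_v113 T hT)
  by_contra hlt
  push Not at hlt
  -- the unique vertex (1.7)
  have hmemIn : T.legIn.1 ∈ univ.filter fun i : Fin T.G.nV => T.G.kind i = .v17 := by simp [hIn]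
  have hmemOut : T.legOut.1 ∈ univ.filter fun i : Fin T.G.nV => T.G.kind i = .v17 := by simp [hOut]
  have hvo : T.legOut.1 = T.legIn.1 :=
    Finset.card_le_one.mp (Nat.lt_succ_iff.mp hlt) _ hmemOut _ hmemIn
  -- every leg at that vertex is external
  have hext : ∀ x : Leg T.G.kind, x.1 = T.legIn.1 → T.G.other x = none := by
    intro x hx
    rcases legs_at_v17 T.G hIn x T.legIn T.legOut hx rfl hvo with h | h | h
    · rw [h]; exact T.in_ext
    · rw [h]; exact T.out_ext
    · exact absurd h T.in_ne_out
  -- but a line leaves some vertex, which is then another vertex, unreachable from the vertex of the external legs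
  obtain ⟨x, hx⟩ := T.G.exists_line
  have hx1 : x.1 ≠ T.legIn.1 := fun h => by rw [hext x h] at hx; exact Bool.false_ne_true hx
  rcases (hT T.legIn.1 x.1).cases_head with h | ⟨c, hadj, -⟩
  · exact hx1 h.symm
  · obtain ⟨x', y', hxy, hx', -⟩ := adj_iff.mp hadj
    rw [hext x' hx'] at hxy
    exact Option.some_ne_none y' hxy.symm

/-- **FOR A LETTER CLASS: one δm²-insertion forces a coupling constant** — if `n17 = 1` then `(d_s, d_v) ≠ (0, 0)`.
[cite: Balaban1983Higgs3, (1.21) p.416, p.417, p.420] -/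
theorem orders_ne_zero_of_n17_le_one (c : B3OnePIChainClasses.LetterClass nbar)
    (h : n17 (B3OnePIChainClasses.rep c.1).G ≤ 1) :
    dsG (B3OnePIChainClasses.rep c.1).G ≠ 0 ∨ dvG (B3OnePIChainClasses.rep c.1).G ≠ 0 := by
  by_contra hc
  push Not at hc
  have := two_le_n17_of_orders_zero (B3OnePIChainClasses.rep c.1) (B3OnePIChainClasses.isLetter_rep c.2).1 hc.1 hc.2
  omega

end Combinatorics
open B3Sect1TwoPoint (idx123)
open B3Eq121CouplingInsertion (dm2Series dm2Term_eq_monomial a123 monSubst monSubst_a123 insert123)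

/-! ## §2 The recursion weight α + 2β: weighted orders of the inserted series -/

section Weights

/-- **THE RECURSION WEIGHT** of p. 417: the order (α, β) of e^αλ^β weighs `α + 2β` (print solves for δm²_{(α,β)} along
`2 ≦ α + 2β ≦ 4`); as weights of the letters: λ ↦ 2, e ↦ 1. [cite: Balaban1983Higgs3, (1.23) p.417] -/
def wt : Fin 2 → ℕ := ![2, 1]

/-- kernel. [cite: Balaban1983Higgs3, (1.23) p.417] -/
@[simp] theorem wt_zero : wt 0 = 2 := rfl

/-- kernel. [cite: Balaban1983Higgs3, (1.23) p.417] -/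
@[simp] theorem wt_one : wt 1 = 1 := rfl

/-- kernel: the monomial e^αλ^β weighs α + 2β. [cite: Balaban1983Higgs3, (1.23) p.417] -/
theorem weight_exponent (α β : ℕ) : Finsupp.weight wt (Finsupp.single 1 α + Finsupp.single 0 β) = α + 2 * β := by
  rw [map_add, Finsupp.weight_single, Finsupp.weight_single, wt_zero, wt_one, smul_eq_mul, smul_eq_mul]
  ring

/-- kernel: the coefficients of the inserted δm²: at an exponent `d`, the sum over the orders (α, β) of (1.23) whose monomial is
`X^d` of δ_{αβ}. [cite: Balaban1983Higgs3, (1.23) p.417] -/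
theorem coeff_dm2Series_eq_sum (δ : ℕ → ℕ → ℝ) (d : Fin 2 →₀ ℕ) :
    coeff d (dm2Series δ) =
      ∑ ab ∈ idx123, if d = Finsupp.single 1 ab.1 + Finsupp.single 0 ab.2 then δ ab.1 ab.2 else 0 := by
  classical
  rw [dm2Series, map_sum]
  refine Finset.sum_congr rfl fun ab _ => ?_
  rw [dm2Term_eq_monomial, coeff_monomial]

/-- **THE INSERTED δm² HAS WEIGHTED ORDER ≥ 2** (every order of (1.23) has α + 2β ≥ 2). [cite: Balaban1983Higgs3, (1.23) p.417] -/
theorem two_le_weightedOrder_dm2Series (δ : ℕ → ℕ → ℝ) : (2 : ℕ∞) ≤ (dm2Series δ).weightedOrder wt := by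
  have key : ((2 : ℕ) : ℕ∞) ≤ (dm2Series δ).weightedOrder wt := by
    refine nat_le_weightedOrder wt fun d hd => ?_
    rw [coeff_dm2Series_eq_sum]
    refine Finset.sum_eq_zero fun ab hab => ?_
    split_ifs with h
    · exfalso
      rw [h, weight_exponent] at hd
      simp only [idx123, Finset.mem_filter] at hab
      omega
    · rfl
  exact_mod_cast key

/-- **TWO INSERTED δm²'s THAT AGREE BELOW WEIGHT N DIFFER BY A SERIES OF WEIGHTED ORDER ≥ N**.
[cite: Balaban1983Higgs3, (1.23) p.417] -/
theorem le_weightedOrder_dm2Series_sub {δ δ' : ℕ → ℕ → ℝ} {N : ℕ} (h : ∀ a b, a + 2 * b < N → δ a b = δ' a b) :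
    (N : ℕ∞) ≤ (dm2Series δ - dm2Series δ').weightedOrder wt := by
  refine nat_le_weightedOrder wt fun d hd => ?_
  rw [map_sub, coeff_dm2Series_eq_sum, coeff_dm2Series_eq_sum, ← Finset.sum_sub_distrib]
  refine Finset.sum_eq_zero fun ab _ => ?_
  split_ifs with hab
  · rw [hab, weight_exponent] at hd
    rw [h _ _ hd, sub_self]
  · rw [sub_zero]

/-- kernel: powers of two series of weighted order ≥ 2 that differ at weighted order ≥ N differ at weighted order ≥ N + 2n
in the (n+1)-st power. [cite: Balaban1983Higgs3, (1.23) p.417] -/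
theorem le_weightedOrder_pow_sub_pow {x y : MvPowerSeries (Fin 2) ℝ} {N : ℕ} (hx : (2 : ℕ∞) ≤ x.weightedOrder wt)
    (hy : (2 : ℕ∞) ≤ y.weightedOrder wt) (hxy : (N : ℕ∞) ≤ (x - y).weightedOrder wt) (n : ℕ) :
    ((N + 2 * n : ℕ) : ℕ∞) ≤ (x ^ (n + 1) - y ^ (n + 1)).weightedOrder wt := by
  induction n with
  | zero => simpa using hxy
  | succ n ih =>
    have hsplit : x ^ (n + 1 + 1) - y ^ (n + 1 + 1) = x * (x ^ (n + 1) - y ^ (n + 1)) + (x - y) * y ^ (n + 1) := by ring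
    rw [hsplit]
    refine le_trans ?_ (min_weightedOrder_le_add wt)
    refine le_min ?_ ?_
    · refine le_trans ?_ (le_weightedOrder_mul wt)
      calc ((N + 2 * (n + 1) : ℕ) : ℕ∞) = (2 : ℕ∞) + ((N + 2 * n : ℕ) : ℕ∞) := by push_cast; ring
        _ ≤ x.weightedOrder wt + (x ^ (n + 1) - y ^ (n + 1)).weightedOrder wt := add_le_add hx ih
    · refine le_trans ?_ (le_weightedOrder_mul wt)
      have hp : ((2 * (n + 1) : ℕ) : ℕ∞) ≤ (y ^ (n + 1)).weightedOrder wt := by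
        refine le_trans ?_ (le_weightedOrder_pow wt (n + 1))
        calc ((2 * (n + 1) : ℕ) : ℕ∞) = (n + 1) • (2 : ℕ∞) := by
              rw [nsmul_eq_mul]; push_cast; ring
          _ ≤ (n + 1) • y.weightedOrder wt := nsmul_le_nsmul_right hy _
      calc ((N + 2 * (n + 1) : ℕ) : ℕ∞) = (N : ℕ∞) + ((2 * (n + 1) : ℕ) : ℕ∞) := by push_cast; ring
        _ ≤ (x - y).weightedOrder wt + (y ^ (n + 1)).weightedOrder wt := add_le_add hxy hp

/-- kernel: `λ^{a}e^{b}` has weighted order ≥ 2a + b. [cite: Balaban1983Higgs3, (1.23) p.417] -/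
theorem le_weightedOrder_X_pow_mul_X_pow (a b : ℕ) :
    ((2 * a + b : ℕ) : ℕ∞) ≤ ((X 0 : MvPowerSeries (Fin 2) ℝ) ^ a * X 1 ^ b).weightedOrder wt := by
  rw [X_pow_eq, X_pow_eq, monomial_mul_monomial, one_mul]
  refine nat_le_weightedOrder wt fun d hd => ?_
  classical
  rw [coeff_monomial, if_neg]
  rintro rfl
  rw [map_add, Finsupp.weight_single, Finsupp.weight_single, wt_zero, wt_one, smul_eq_mul, smul_eq_mul] at hd
  omega

/-- **THE SERIES INSERTED FOR ONE GRAPH, UNDER A CHANGE OF δm² BELOW WEIGHT N**: for orders (d_s, d_v, n + 1) the two inserted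
monomials `λ^{d_s}e^{d_v}δm²(e,λ)^{n+1}` differ by a series of weighted order `≥ N + 2n + 2d_s + d_v`.
[cite: Balaban1983Higgs3, (1.23) p.417] [cite: Balaban1983Higgs3, p.417] -/
theorem le_weightedOrder_monSubst_sub {δ δ' : ℕ → ℕ → ℝ} {N : ℕ} (h : ∀ a b, a + 2 * b < N → δ a b = δ' a b)
    (ds dv n : ℕ) :
    ((N + 2 * n + 2 * ds + dv : ℕ) : ℕ∞) ≤
      ((X 0 : MvPowerSeries (Fin 2) ℝ) ^ ds * X 1 ^ dv * dm2Series δ ^ (n + 1) -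
        X 0 ^ ds * X 1 ^ dv * dm2Series δ' ^ (n + 1)).weightedOrder wt := by
  rw [← mul_sub]
  have h3 := add_le_add (le_weightedOrder_X_pow_mul_X_pow ds dv)
    (le_weightedOrder_pow_sub_pow (two_le_weightedOrder_dm2Series δ) (two_le_weightedOrder_dm2Series δ')
      (le_weightedOrder_dm2Series_sub h) n)
  refine le_trans (le_of_eq ?_) (le_trans h3 (le_weightedOrder_mul wt))
  push_cast
  ring

end Weights

/-! ## §3 TRIANGULARITY: the order-(α, β) coefficient of the inserted self-energy sees δm²_{(α′,β′)} only for α′ + 2β′ < α + 2β -/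

section Triangular

open B3Eq121OnePIChains (sigmaSeries)
open B3ChainRegroupingValues (LetterDressing)
open B3OnePIChainClassValues (classRegrouping)
open B3Eq121SymmetryWeights (letterWeight)
open B3Eq121LetterClassOrders (letterDeg n17)
open B3OnePIChainClasses (rep LetterClass)
open B3ClassOrders420 (dsG dvG)
open B3Eq121CouplingInsertion (coeff_letterSeries_inserted)

variable {nbar : ℕ} {SF VF OF IS IV IO : Type*} [Fintype IS] [Fintype IV] [Fintype IO] [DecidableEq IS]
  (bS : IS → SF) (bV : IV → VF) (bO : IO → OF) (Dc : LetterDressing (classRegrouping nbar) SF VF OF IS IV IO)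

/-- kernel: for ONE LETTER CLASS, the order-(α, β) coefficient of its inserted monomial `λ^{d_s}e^{d_v}δm²(e,λ)^{n17}` does not
change when δ is changed at weights `≥ α + 2β` — by `two_le_n17_of_orders_zero` the only dangerous case (n17 = 1, d_s = d_v = 0:
the bare −δm²) is not a letter. [cite: Balaban1983Higgs3, p.417] [cite: Balaban1983Higgs3, (1.21) p.416] -/
theorem coeff_monSubst_letter_congr {δ δ' : ℕ → ℕ → ℝ} (α β : ℕ) (h : ∀ a b, a + 2 * b < α + 2 * β → δ a b = δ' a b)
    (c : LetterClass nbar) :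
    coeff (Finsupp.single 1 α + Finsupp.single 0 β)
        ((X 0 : MvPowerSeries (Fin 2) ℝ) ^ dsG (rep c.1).G * X 1 ^ dvG (rep c.1).G * dm2Series δ ^ n17 (rep c.1).G) =
      coeff (Finsupp.single 1 α + Finsupp.single 0 β)
        ((X 0 : MvPowerSeries (Fin 2) ℝ) ^ dsG (rep c.1).G * X 1 ^ dvG (rep c.1).G * dm2Series δ' ^ n17 (rep c.1).G) := by
  rcases Nat.eq_zero_or_eq_succ_pred (n17 (rep c.1).G) with h0 | hsucc
  · rw [h0, pow_zero, pow_zero]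
  · rw [hsucc, ← sub_eq_zero, ← map_sub]
    refine coeff_eq_zero_of_lt_weightedOrder wt (lt_of_lt_of_le ?_ (le_weightedOrder_monSubst_sub h _ _ _))
    rw [weight_exponent]
    have hcase : 1 ≤ (n17 (rep c.1).G).pred ∨ (dsG (rep c.1).G ≠ 0 ∨ dvG (rep c.1).G ≠ 0) := by
      rcases Nat.lt_or_ge 0 (n17 (rep c.1).G).pred with hp | hp
      · exact Or.inl hp
      · exact Or.inr (orders_ne_zero_of_n17_le_one c (by omega))
    exact_mod_cast (by rcases hcase with h1 | h2 | h3 <;> omega)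

/-- **TRIANGULARITY OF THE INSERTED SELF-ENERGY** (p. 417 *"This equation can be solved recursively if δm² and Σ^ε are expanded
into power series in e, λ"*): the coefficient of e^αλ^β in the inserted letter series depends on the inserted coefficients
δm²_{(α′,β′)} only through those of weight α′ + 2β′ < α + 2β. [cite: Balaban1983Higgs3, p.417] [cite: Balaban1983Higgs3, (1.23) p.417] -/
theorem coeff_letterSeries_inserted_congr {δ δ' : ℕ → ℕ → ℝ} (α β : ℕ)
    (h : ∀ a b, a + 2 * b < α + 2 * β → δ a b = δ' a b) :
    coeff (Finsupp.single 1 α + Finsupp.single 0 β)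
        (insert123 δ (sigmaSeries (fun c => letterWeight c • (Dc c).kernel bS bV bO) letterDeg)) =
      coeff (Finsupp.single 1 α + Finsupp.single 0 β)
        (insert123 δ' (sigmaSeries (fun c => letterWeight c • (Dc c).kernel bS bV bO) letterDeg)) := by
  rw [coeff_letterSeries_inserted, coeff_letterSeries_inserted]
  exact Finset.sum_congr rfl fun c _ => by rw [coeff_monSubst_letter_congr α β h c]

end Triangular

open B3Sect1TwoPoint (idx123)
open B3Eq121CouplingInsertion (dm2Series a123 insert123)
open B3Eq121OnePIChains (sigmaSeries)
open B3ChainRegroupingValues (LetterDressing)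
open B3OnePIChainClassValues (classRegrouping)
open B3Eq121SymmetryWeights (letterWeight)
open B3Eq121LetterClassOrders (letterDeg)

/-! ## §4 THE DEFINING EQUATIONS OF δm²_{(α,β)} ARE SOLVED RECURSIVELY (p. 417) -/

section Recursion

variable {nbar : ℕ} {SF VF OF IS IV IO : Type*} [Fintype IS] [Fintype IV] [Fintype IO] [DecidableEq IS]
  (bS : IS → SF) (bV : IV → VF) (bO : IO → OF) (Dc : LetterDressing (classRegrouping nbar) SF VF OF IS IV IO)
  (L : ℕ → ℕ → Matrix IS IS ℝ → ℝ)

/-- **THE RIGHT SIDE OF THE DEFINING EQUATION OF δm²_{(α,β)}** (p. 417, verbatim: *"The counterterms δm²_{(α,β)} are defined by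
the equations −δm²_{(α,β)} + Σ_{x∈T_ε} ε^dΣ^ε_{(α,β)}(x) = 0"*; and *"In our case δm² will be defined by the terms of order ≦ 4"*):
for an order (α, β) of (1.23) (`idx123`), the SUPPLIED functional `L α β` (print: K ↦ Σ_{x′}ε^dK(x, x′), r15's `dm2Graph`; any
functional of the kernel is allowed here) applied to the order-(α, β) coefficient Σ^ε_{(α,β)} of the inserted symmetry-weighted
letter series; `0` at the other orders. [cite: Balaban1983Higgs3, (1.23) p.417] [cite: Balaban1983Higgs3, p.417] -/
noncomputable def dm2Rhs (δ : ℕ → ℕ → ℝ) (α β : ℕ) : ℝ :=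
  if (α, β) ∈ idx123 then
    L α β (coeff (Finsupp.single 1 α + Finsupp.single 0 β)
      (insert123 δ (sigmaSeries (fun c => letterWeight c • (Dc c).kernel bS bV bO) letterDeg)))
  else 0

/-- **δ SOLVES THE DEFINING EQUATIONS OF (1.23)**: `δ_{αβ} = L_{αβ}(Σ^ε_{(α,β)}[δ])` at the seven orders and `δ_{αβ} = 0`
elsewhere — a FIXED-POINT condition, since Σ^ε_{(α,β)} is computed with δ inserted. [cite: Balaban1983Higgs3, (1.23) p.417] -/
def SolvesEq123 (δ : ℕ → ℕ → ℝ) : Prop :=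
  ∀ α β, δ α β = dm2Rhs bS bV bO Dc L δ α β

/-- **THE RIGHT SIDE AT ORDER (α, β) SEES δ ONLY BELOW WEIGHT α + 2β** (triangularity, `coeff_letterSeries_inserted_congr`).
[cite: Balaban1983Higgs3, p.417] [cite: Balaban1983Higgs3, (1.23) p.417] -/
theorem dm2Rhs_congr {δ δ' : ℕ → ℕ → ℝ} (α β : ℕ) (h : ∀ a b, a + 2 * b < α + 2 * β → δ a b = δ' a b) :
    dm2Rhs bS bV bO Dc L δ α β = dm2Rhs bS bV bO Dc L δ' α β := by
  unfold dm2Rhs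
  split_ifs
  · rw [coeff_letterSeries_inserted_congr bS bV bO Dc α β h]
  · rfl

/-- **THE RECURSION** (p. 417 *"This equation can be solved recursively"*): `approx W` is the solution at the orders of weight
`< W` (and `0` at the others), built weight by weight — the orders of weight `W` are computed from `approx W`.
[cite: Balaban1983Higgs3, p.417] [cite: Balaban1983Higgs3, (1.23) p.417] -/
noncomputable def approx : ℕ → ℕ → ℕ → ℝ
  | 0 => fun _ _ => 0
  | W + 1 => fun a b =>
      if a + 2 * b < W then approx W a b else if a + 2 * b = W then dm2Rhs bS bV bO Dc L (approx W) a b else 0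

/-- kernel: once computed, a value is never changed. [cite: Balaban1983Higgs3, p.417] -/
theorem approx_stable {W V : ℕ} (hWV : W ≤ V) {a b : ℕ} (hab : a + 2 * b < W) :
    approx bS bV bO Dc L V a b = approx bS bV bO Dc L W a b := by
  induction V, hWV using Nat.le_induction with
  | base => rfl
  | succ V hWV ih =>
    rw [← ih]
    show (if a + 2 * b < V then approx bS bV bO Dc L V a b
      else if a + 2 * b = V then dm2Rhs bS bV bO Dc L (approx bS bV bO Dc L V) a b else 0) = _
    rw [if_pos (by omega)]

/-- **THE RECURSIVELY CONSTRUCTED COUNTERTERM COEFFICIENTS δm²_{(α,β)}**. [cite: Balaban1983Higgs3, p.417]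
[cite: Balaban1983Higgs3, (1.23) p.417] -/
noncomputable def dm2Sol (a b : ℕ) : ℝ :=
  approx bS bV bO Dc L (a + 2 * b + 1) a b

/-- kernel: the value at (a, b) is the right side evaluated on the stage of weight a + 2b. [cite: Balaban1983Higgs3, p.417] -/
theorem dm2Sol_eq_rhs_approx (a b : ℕ) :
    dm2Sol bS bV bO Dc L a b = dm2Rhs bS bV bO Dc L (approx bS bV bO Dc L (a + 2 * b)) a b := by
  show (if a + 2 * b < a + 2 * b then approx bS bV bO Dc L (a + 2 * b) a b
    else if a + 2 * b = a + 2 * b then dm2Rhs bS bV bO Dc L (approx bS bV bO Dc L (a + 2 * b)) a b else 0) = _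
  rw [if_neg (lt_irrefl _), if_pos rfl]

/-- kernel: every stage agrees with the final solution below its weight. [cite: Balaban1983Higgs3, p.417] -/
theorem approx_eq_dm2Sol_of_lt {W a b : ℕ} (h : a + 2 * b < W) :
    approx bS bV bO Dc L W a b = dm2Sol bS bV bO Dc L a b :=
  approx_stable bS bV bO Dc L (Nat.succ_le_of_lt h) (Nat.lt_succ_self _)

/-- **EXISTENCE: THE RECURSIVELY CONSTRUCTED δ SOLVES THE DEFINING EQUATIONS** (p. 417 *"This equation can be solved recursively if
δm² and Σ^ε are expanded into power series in e, λ"*) — by triangularity, the right side at (α, β) evaluated on the stage of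
weight α + 2β equals the right side evaluated on the full solution. [cite: Balaban1983Higgs3, p.417] [cite: Balaban1983Higgs3, (1.23) p.417] -/
theorem dm2Sol_solves : SolvesEq123 bS bV bO Dc L (dm2Sol bS bV bO Dc L) := fun α β => by
  rw [dm2Sol_eq_rhs_approx]
  exact dm2Rhs_congr bS bV bO Dc L α β fun a b hab => approx_eq_dm2Sol_of_lt bS bV bO Dc L hab

/-- **UNIQUENESS: THE DEFINING EQUATIONS HAVE AT MOST ONE SOLUTION** (strong induction on the weight α + 2β, triangularity).
[cite: Balaban1983Higgs3, p.417] [cite: Balaban1983Higgs3, (1.23) p.417] -/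
theorem solvesEq123_unique {δ δ' : ℕ → ℕ → ℝ} (h : SolvesEq123 bS bV bO Dc L δ) (h' : SolvesEq123 bS bV bO Dc L δ') :
    δ = δ' := by
  suffices key : ∀ W a b, a + 2 * b = W → δ a b = δ' a b from funext fun a => funext fun b => key _ a b rfl
  intro W
  induction W using Nat.strong_induction_on with
  | _ W ih =>
    intro a b hW
    rw [h a b, h' a b]
    exact dm2Rhs_congr bS bV bO Dc L a b fun a' b' hlt => ih (a' + 2 * b') (by omega) a' b' rfl

/-- **p. 417: THE DEFINING EQUATIONS OF THE MASS COUNTERTERM COEFFICIENTS HAVE EXACTLY ONE SOLUTION**, for every supplied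
functional `L` and every dressing of the letters. [cite: Balaban1983Higgs3, p.417] [cite: Balaban1983Higgs3, (1.23) p.417] -/
theorem existsUnique_solvesEq123 : ∃! δ : ℕ → ℕ → ℝ, SolvesEq123 bS bV bO Dc L δ :=
  ⟨dm2Sol bS bV bO Dc L, dm2Sol_solves bS bV bO Dc L,
    fun _ hδ => solvesEq123_unique bS bV bO Dc L hδ (dm2Sol_solves bS bV bO Dc L)⟩

/-- **THE SOLUTION LIVES ON THE SEVEN ORDERS OF (1.23)**: δm²_{(α,β)} = 0 unless 2 ≦ α + 2β ≦ 4 (p. 417 *"δm² will be defined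
by the terms of order ≦ 4"*). [cite: Balaban1983Higgs3, (1.23) p.417] -/
theorem dm2Sol_eq_zero_of_not_mem {a b : ℕ} (h : (a, b) ∉ idx123) : dm2Sol bS bV bO Dc L a b = 0 := by
  rw [dm2Sol_solves bS bV bO Dc L a b, dm2Rhs, if_neg h]

/-- **ON THE SEVEN ORDERS, THE PRINTED EQUATION HOLDS**: `−δm²_{(α,β)} + L_{αβ}(Σ^ε_{(α,β)}[δm²]) = 0`.
[cite: Balaban1983Higgs3, (1.23) p.417] -/
theorem dm2Sol_eq123 {α β : ℕ} (h : (α, β) ∈ idx123) :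
    -dm2Sol bS bV bO Dc L α β + L α β (coeff (Finsupp.single 1 α + Finsupp.single 0 β)
      (insert123 (dm2Sol bS bV bO Dc L) (sigmaSeries (fun c => letterWeight c • (Dc c).kernel bS bV bO) letterDeg))) = 0 := by
  rw [dm2Sol_solves bS bV bO Dc L α β, dm2Rhs, if_pos h, neg_add_cancel]

/-- **WITH PRINT'S OWN FUNCTIONAL** δm²_G(x₀) = Σ_{x′∈T_ε} ε^dΣ^ε_G(x₀, x′) (r15's `B3Sect1TwoPoint.dm2Graph`, p. 417 *"δm²_G = Σ_{x′∈T_ε}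
ε^dΣ^ε_G(x − x′) will be represented by the same graph G but with both external legs localized in x and with the summation over
x′"*): the recursively constructed coefficients satisfy `−δm²_{(α,β)} + Σ_{x′} ε^d Σ^ε_{(α,β)}[δm²](x₀, x′) = 0` on the seven
orders. [cite: Balaban1983Higgs3, (1.23) p.417] -/
theorem dm2Sol_eq123_dm2Graph (epsd : ℝ) (x₀ : IS) {α β : ℕ} (h : (α, β) ∈ idx123) :
    -dm2Sol bS bV bO Dc (fun _ _ K => B3Sect1TwoPoint.dm2Graph epsd (fun x x' => K x x') x₀) α β +
      B3Sect1TwoPoint.dm2Graph epsd (fun x x' => coeff (Finsupp.single 1 α + Finsupp.single 0 β)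
        (insert123 (dm2Sol bS bV bO Dc (fun _ _ K => B3Sect1TwoPoint.dm2Graph epsd (fun x x' => K x x') x₀))
          (sigmaSeries (fun c => letterWeight c • (Dc c).kernel bS bV bO) letterDeg)) x x') x₀ = 0 :=
  dm2Sol_eq123 bS bV bO Dc _ h

/-- **PER-GRAPH COUNTERTERMS** (p. 417, verbatim: *"A term e^αλ^βΣ^ε_{(α,β)} can be written also as a sum of terms Σ^ε_G, the
summation over a family of one-particle-irreducible graphs with two external legs of scalar fields. The same for the term
e^αλ^βδm²_{(α,β)}, and we define δm²_G by the equation −δm²_G + Σ_{x∈T_ε} ε^dΣ^ε_G(x) = 0. This implies some obvious graphical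
representation of the terms of δm²."*): for an ADDITIVE functional `L`, the solution at an order (α, β) of (1.23) is the finite
sum, over the letter classes `c` of total order ≤ α + β, of the per-class counterterms
`δm²_c := L_{αβ}(coeff_{(β,α)}(λ^{d_s}e^{d_v}δm²(e,λ)^{n17}) · (1/|Aut c|)·K(rep c))` (FILE 1's `coeff_letterSeries_inserted`).
[cite: Balaban1983Higgs3, (1.23) p.417] -/
theorem dm2Sol_eq_sum_letterClasses (L : ℕ → ℕ → (Matrix IS IS ℝ →+ ℝ)) {α β : ℕ} (h : (α, β) ∈ idx123) :
    dm2Sol bS bV bO Dc (fun a b => L a b) α β =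
      ∑ c ∈ (B3Eq121LetterClassOrders.finite_letterDeg_degree_le (nbar := nbar)
          (Finsupp.single (1 : Fin 2) α + Finsupp.single 0 β).degree).toFinset,
        L α β (coeff (Finsupp.single 1 α + Finsupp.single 0 β)
          ((X 0 : MvPowerSeries (Fin 2) ℝ) ^ B3ClassOrders420.dsG (B3OnePIChainClasses.rep c.1).G *
            X 1 ^ B3ClassOrders420.dvG (B3OnePIChainClasses.rep c.1).G *
            dm2Series (dm2Sol bS bV bO Dc (fun a b => L a b)) ^ B3Eq121LetterClassOrders.n17 (B3OnePIChainClasses.rep c.1).G) •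
          (letterWeight c • (Dc c).kernel bS bV bO)) := by
  rw [dm2Sol_solves bS bV bO Dc (fun a b => L a b) α β, dm2Rhs, if_pos h,
    B3Eq121CouplingInsertion.coeff_letterSeries_inserted, map_sum]

end Recursion

end Literature.MathematicalPhysics.QuantumFieldTheory.Balaban1983to89.B3Eq123RecursiveSolution
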